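import Summits.CriticalPhenomena.PercolationContinuityZ3.Theorems.PercNearOneGluingNoHeavyLowerTailKnQuestion8PocketQ9Cov
import Summits.CriticalPhenomena.PercolationContinuityZ3.Theorems.PercNearOneGluingNoHeavyLowerTailKnQuestion8PocketQ9Attach
import Summits.CriticalPhenomena.PercolationContinuityZ3.Theorems.PercNearOneGluingNoHeavyLowerTailKnQuestion8PocketPieces
import HarnessLib

/-!
# KN Question 8/9 at three relays — the owner's half (P1*D) of the pocket certificate HOLDS for the Question-9 pocket

Support file (`--supports stmt-CriticalPhenomena-4575`, closed), prover `prim-cplus-coupling` (gen 21).  No definitions, no named facts,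
no sorries; standard axioms.  Memo `prim-cplus-coupling/A5-COUPLING-gen21.md` §0(1).

prim-lf-2's pocket-designated dual certificate (memo POCKET-CERT-gen16 §0(3), §3) for Kozma–Nitzan's Question 8 / MC-D at three relays: with
owner `x`, marker `y`, weak relay `z`, observer `o`, pocket event `Dp`, `E1 = {x↮y} ∩ {x↮z}`, `F = {x↔y} ∩ {x↮z}`, `E2 = {y↮x} ∩ {y↮z}`,
`a = μ({x↔o} ∩ E1)`, `d = μ({x↔o} ∩ F)`, `b = μ({y↔o} ∩ E2)`, `mDE1 = μ(Dp ∩ E1)`, `mDF = μ(Dp ∩ F)`, `mDE2 = μ(Dp ∩ E2)`, the split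
`t_D = a·mDE2/(a·mDE2 + b·mDE1)` and multiplier `λ_D = (a + t_D d)/(mDE1 + mDF)`, the owner's half is
  (P1*D)  `λ_D · ∫_{Dp ∩ {x↮z}} G(C_x) ≤ ∫_{{x↔o} ∩ E1} G(C_x) + t_D ∫_{{x↔o} ∩ F} G(C_x)`.
`PocketCert.p1star_pocket_of_pieces` (prim-lf-2) reduces it to the two pieces (BHK-D) and (P1**-D) = PCOV.  For the QUESTION-9 POCKET
`Dp = {C_o = {o}} = starEvent o ∅` both pieces are now theorems (`PocketCert.attach_questionNine`, `PocketCert.pcov_questionNine`, this gen),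
so THIS FILE records (P1*D) itself for that pocket, for indicator functionals `G = 1_𝒰` (`𝒰` an up-set of vertex sets — the case
`𝒰 = {K | b ∈ K}` is the one entering (41)): `PocketCert.p1star_questionNine`.  (The marker's half (P2*D) is the same statement with
`x, y` exchanged; the weak-relay part (Z*D) of the certificate remains open for every pocket family.)
[cite: KozmaNitzan2024, Questions 8–9 (§5.5 p. 36), §5.1 (pp. 31–32)] [cite: VandenbergHaggstromKahn2005, Thms. 1.3–1.5 (pp. 6–8), Thm. 2.1 (p. 9)]
-/

namespace Summit.CriticalPhenomena.PercolationContinuityZ3.Theorems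

open MeasureTheory Set Literature.Probability.LatticeModels Literature.Probability.Percolation
open scoped Classical
open KNPreFKG

noncomputable section

namespace PocketCert

variable {V : Type*} [Fintype V]

/-- **(P1*D) for the Question-9 pocket, indicator functionals.**  `x, y, z ≠ o`, `x ≠ y`, `𝒰` an up-set, `σ_∅ = starEvent o ∅`,
`E1 = {x↮y} ∩ {x↮z}`, `F = {x↔y} ∩ {x↮z}`, `E2 = {y↮x} ∩ {y↮z}`, `U = {C_x ∈ 𝒰}`; for every `t ∈ [0,1]` and `λ` with
`t·(a·mDE2 + b·mDE1) = a·mDE2` and `λ·(mDE1 + mDF) = a + t·d` (the certificate's `t_D`, `λ_D`; `mDE1, mDE2 > 0`):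
`λ·(μ(σ_∅ ∩ E1 ∩ U) + μ(σ_∅ ∩ F ∩ U)) ≤ μ({x↔o} ∩ E1 ∩ U) + t·μ({x↔o} ∩ F ∩ U)`.
From `attach_questionNine` ((BHK-D)), `pcov_questionNine` ((P1**-D)) and prim-lf-2's `p1star_pocket_of_pieces`.
[cite: KozmaNitzan2024, Questions 8–9 (§5.5 p. 36), §5.1 (pp. 31–32)] -/
theorem p1star_questionNine (w : Sym2 V → unitInterval) (o x y z : V) (hxo : x ≠ o) (hyo : y ≠ o) (hzo : z ≠ o)
    (hxy : x ≠ y) (𝒰 : Set (Set V)) (h𝒰 : IsUpperSet 𝒰) (t lam : ℝ) (ht0 : 0 ≤ t) (ht1 : t ≤ 1)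
    (hE1 : 0 < (prodBernoulli w).real (starEvent o (∅ : Set V) ∩
      ({ω : BondConfig V | ¬ (openGraph ω).Reachable x y} ∩ {ω | ¬ (openGraph ω).Reachable x z})))
    (hE2 : 0 < (prodBernoulli w).real (starEvent o (∅ : Set V) ∩
      ({ω : BondConfig V | ¬ (openGraph ω).Reachable y x} ∩ {ω | ¬ (openGraph ω).Reachable y z})))
    (ht : t * ((prodBernoulli w).real (openConn x o ∩ ({ω : BondConfig V | ¬ (openGraph ω).Reachable x y} ∩
            {ω | ¬ (openGraph ω).Reachable x z})) *
          (prodBernoulli w).real (starEvent o (∅ : Set V) ∩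
            ({ω : BondConfig V | ¬ (openGraph ω).Reachable y x} ∩ {ω | ¬ (openGraph ω).Reachable y z})) +
        (prodBernoulli w).real (openConn y o ∩ ({ω : BondConfig V | ¬ (openGraph ω).Reachable y x} ∩
            {ω | ¬ (openGraph ω).Reachable y z})) *
          (prodBernoulli w).real (starEvent o (∅ : Set V) ∩
            ({ω : BondConfig V | ¬ (openGraph ω).Reachable x y} ∩ {ω | ¬ (openGraph ω).Reachable x z}))) =
      (prodBernoulli w).real (openConn x o ∩ ({ω : BondConfig V | ¬ (openGraph ω).Reachable x y} ∩
          {ω | ¬ (openGraph ω).Reachable x z})) *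
        (prodBernoulli w).real (starEvent o (∅ : Set V) ∩
          ({ω : BondConfig V | ¬ (openGraph ω).Reachable y x} ∩ {ω | ¬ (openGraph ω).Reachable y z})))
    (hlam : lam * ((prodBernoulli w).real (starEvent o (∅ : Set V) ∩
          ({ω : BondConfig V | ¬ (openGraph ω).Reachable x y} ∩ {ω | ¬ (openGraph ω).Reachable x z})) +
        (prodBernoulli w).real (starEvent o (∅ : Set V) ∩ (openConn x y ∩ {ω | ¬ (openGraph ω).Reachable x z}))) =
      (prodBernoulli w).real (openConn x o ∩ ({ω : BondConfig V | ¬ (openGraph ω).Reachable x y} ∩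
          {ω | ¬ (openGraph ω).Reachable x z})) +
        t * (prodBernoulli w).real (openConn x o ∩ (openConn x y ∩ {ω | ¬ (openGraph ω).Reachable x z}))) :
    lam * ((prodBernoulli w).real (starEvent o (∅ : Set V) ∩
          ({ω : BondConfig V | ¬ (openGraph ω).Reachable x y} ∩ {ω | ¬ (openGraph ω).Reachable x z}) ∩ {ω | openCluster ω x ∈ 𝒰}) +
        (prodBernoulli w).real (starEvent o (∅ : Set V) ∩ (openConn x y ∩ {ω | ¬ (openGraph ω).Reachable x z}) ∩
          {ω | openCluster ω x ∈ 𝒰})) ≤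
      (prodBernoulli w).real (openConn x o ∩ ({ω : BondConfig V | ¬ (openGraph ω).Reachable x y} ∩
          {ω | ¬ (openGraph ω).Reachable x z}) ∩ {ω | openCluster ω x ∈ 𝒰}) +
        t * (prodBernoulli w).real (openConn x o ∩ (openConn x y ∩ {ω | ¬ (openGraph ω).Reachable x z}) ∩
          {ω | openCluster ω x ∈ 𝒰}) := by
  classical
  set μ := prodBernoulli w with hμ
  have hn := fun (S' : Set (BondConfig V)) => (measureReal_nonneg : 0 ≤ μ.real S')
  set σ0 : Set (BondConfig V) := starEvent o (∅ : Set V) with hσ0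
  set E1 : Set (BondConfig V) := {ω : BondConfig V | ¬ (openGraph ω).Reachable x y} ∩
      {ω | ¬ (openGraph ω).Reachable x z} with hE1def
  set FF : Set (BondConfig V) := (openConn x y : Set (BondConfig V)) ∩ {ω | ¬ (openGraph ω).Reachable x z} with hFF
  set E2 : Set (BondConfig V) := {ω : BondConfig V | ¬ (openGraph ω).Reachable y x} ∩
      {ω | ¬ (openGraph ω).Reachable y z} with hE2def
  set D : Set (BondConfig V) := {ω : BondConfig V | ¬ (openGraph ω).Reachable x z} with hD
  set AU : Set (BondConfig V) := {ω : BondConfig V | openCluster ω x ∈ 𝒰} with hAU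
  set XY : Set (BondConfig V) := (openConn x y : Set (BondConfig V)) with hXY
  set NXY : Set (BondConfig V) := {ω : BondConfig V | ¬ (openGraph ω).Reachable x y} with hNXY
  -- the two pieces
  have hBHK := attach_questionNine w o x y z hxo hyo hzo 𝒰 h𝒰
  have hcov := pcov_questionNine w o x y z hxo hyo hzo hxy 𝒰 h𝒰
  -- splitting `D = E1 ⊔ F` in the masses of `pcov_questionNine`
  have hmeas : ∀ A : Set (BondConfig V), MeasurableSet A := fun _ => MeasurableSet.of_discrete
  have splitQ : ∀ Q : Set (BondConfig V), μ.real (Q ∩ D) = μ.real (Q ∩ E1) + μ.real (Q ∩ FF) := by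
    intro Q
    have h := measureReal_inter_add_sdiff (μ := μ) (s := Q ∩ D) (t := NXY) (hmeas NXY)
    have e1 : (Q ∩ D) ∩ NXY = Q ∩ E1 := by
      ext ω; simp only [hD, hNXY, hE1def, mem_inter_iff, mem_setOf_eq]; tauto
    have e2 : (Q ∩ D) \ NXY = Q ∩ FF := by
      ext ω
      simp only [hD, hNXY, hFF, hXY, openConn, mem_inter_iff, mem_sdiff, mem_setOf_eq, not_not]
      tauto
    rw [e1, e2] at h
    exact h.symm
  have sE1σ : σ0 ∩ D ∩ NXY = σ0 ∩ E1 := by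
    ext ω; simp only [hD, hNXY, hE1def, mem_inter_iff, mem_setOf_eq]; tauto
  have sFσ : σ0 ∩ D ∩ XY = σ0 ∩ FF := by
    ext ω; simp only [hD, hXY, hFF, mem_inter_iff, mem_setOf_eq]; tauto
  have sE1σU : σ0 ∩ D ∩ NXY ∩ AU = σ0 ∩ E1 ∩ AU := by rw [sE1σ]
  have sFσU : σ0 ∩ D ∩ XY ∩ AU = σ0 ∩ FF ∩ AU := by rw [sFσ]
  have nσ : μ.real (σ0 ∩ D) = μ.real (σ0 ∩ E1) + μ.real (σ0 ∩ FF) := splitQ σ0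
  have nO : μ.real (openConn x o ∩ D) = μ.real (openConn x o ∩ E1) + μ.real (openConn x o ∩ FF) := splitQ (openConn x o)
  have nσU : μ.real (σ0 ∩ D ∩ AU) = μ.real (σ0 ∩ E1 ∩ AU) + μ.real (σ0 ∩ FF ∩ AU) := by
    have h := splitQ (σ0 ∩ AU)
    have e0 : σ0 ∩ AU ∩ D = σ0 ∩ D ∩ AU := by ext ω; simp only [mem_inter_iff]; tauto
    have e1 : σ0 ∩ AU ∩ E1 = σ0 ∩ E1 ∩ AU := by ext ω; simp only [mem_inter_iff]; tauto
    have e2 : σ0 ∩ AU ∩ FF = σ0 ∩ FF ∩ AU := by ext ω; simp only [mem_inter_iff]; tauto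
    rw [e0, e1, e2] at h
    exact h
  have nOU : μ.real (openConn x o ∩ D ∩ AU) = μ.real (openConn x o ∩ E1 ∩ AU) + μ.real (openConn x o ∩ FF ∩ AU) := by
    have h := splitQ (openConn x o ∩ AU)
    have e0 : openConn x o ∩ AU ∩ D = openConn x o ∩ D ∩ AU := by ext ω; simp only [mem_inter_iff]; tauto
    have e1 : openConn x o ∩ AU ∩ E1 = openConn x o ∩ E1 ∩ AU := by ext ω; simp only [mem_inter_iff]; tauto
    have e2 : openConn x o ∩ AU ∩ FF = openConn x o ∩ FF ∩ AU := by ext ω; simp only [mem_inter_iff]; tauto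
    rw [e0, e1, e2] at h
    exact h
  -- rewrite `hcov` in the shape of `p1star_pocket_of_pieces`
  rw [sE1σU, sFσU, sE1σ, sFσ, nσ, nO, nσU, nOU] at hcov
  -- apply the bookkeeping lemma
  exact p1star_pocket_of_pieces (μ.real (openConn x o ∩ E1 ∩ AU)) (μ.real (openConn x o ∩ FF ∩ AU))
    (μ.real (σ0 ∩ E1 ∩ AU)) (μ.real (σ0 ∩ FF ∩ AU)) (μ.real (openConn x o ∩ E1)) (μ.real (openConn x o ∩ FF))
    (μ.real (openConn y o ∩ E2)) (μ.real (σ0 ∩ E1)) (μ.real (σ0 ∩ FF)) (μ.real (σ0 ∩ E2)) t lam ht0 ht1 hE1 hE2 (hn _)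
    ht hlam hBHK (by linarith [hcov])

end PocketCert

end

end Summit.CriticalPhenomena.PercolationContinuityZ3.Theorems
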